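import Summits.CriticalPhenomena.PercolationContinuityZ3.Theorems.PercNearOneGluingNoHeavyConstsOneCopyRepelSlices
import HarnessLib

/-!
# ONE-COPY REPULSION HOLDS FIBREWISE — proof of `Consts.OneCopyRepelBHK`, part 2 of 2: slices and assembly (PAPER-2 track (ii))

builds on p205010 (kernel theorem, internal audit signed; external expert review pending).  Support file (`--supports
stmt-CriticalPhenomena-4575`), lead seat `prim-nh-lead-4575` (gen 106); memo `run/shared/lean/prim/prim-nh-lead-4575/LEAD-GEN106.md` §5.
Theorems only; no sorries; standard axioms.  Part 1 (`…ConstsOneCopyRepelSlices.lean`): cube inequality, reach-set locality, domination.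

`Consts.OneCopyRepelBHK` (typed as an open conjecture in `…ConstsOneCopyBHK.lean`, lead gen 106) says: for two copies `(a, a ∆ M)` of a
folding fibre, a source set `S`, a vertex set `T` and increasing cluster predicates `P, Q`, conditioning the FIRST copy to avoid `T`
(`a ∈ B = {S ↮ T}`, second copy free) keeps the two events more aligned within the copy than across copies:
`N(B∩U_P ; U_Q) + N(B∩U_Q ; U_P) ≤ N(B∩U_P∩U_Q ; ⊤) + N(B ; U_P∩U_Q)`.  THIS FILE PROVES IT (`Consts.oneCopyRepelBHK_holds`).

PROOF (lead gen 106).  Slice the fibre by the open cluster of `T` in the conditioned copy: `W = R_T(a)` (the vertices joined to `T` in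
`a`; `a ∈ B` iff `S ∩ W = ∅`) and `x = a \ F_W`, where `F_W = M ∩ {pairs with both ends outside W}` is the block of reflected
coordinates away from `W`.  On a slice, `a = x ∪ y` with `y ⊆ F_W` FREE (the slice is the cube `2^{F_W}`; `R_T(x ∪ y) = R_T(x) = W`
because no pair of `a` leaves `W` — `OneCopy.reachSet_sdiff_eq`, `OneCopy.reachSet_eq_of_sdiff`), the second copy is `(x ∪ y) ∆ M = (x ∆ M) \ y`, and
* `y ↦ P(C_S(x ∪ y))`, `y ↦ Q(C_S(x ∪ y))` are INCREASING, `y ↦ P(C_S((x ∆ M) \ y))`, `y ↦ Q(…)` DECREASING;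
* domination: `#{y : P(C_S(x ∪ y))} ≤ #{y : P(C_S((x ∆ M) \ y))}` — reflect `y ↦ F_W \ y` and note `C_S(x ∪ y) ⊆ C_S((x ∆ M) \ (F_W \ y))`
  (on `{S ↮ W}` the cluster `C_S(x ∪ y)` only uses the pairs of `u ∪ y` away from `W`, all of which are open in the other copy:
  `OneCopy.cluster_subset_reflected`);
* Kleitman's lemma on the cube four times (up/up, down/down, up/down twice: the tree's `FoldingFibre.card_filter_mul_card_filter_le`,
  `FoldingFibre.card_filter_and_mul_card_le`) gives `Z·(N₀₁ + N₁₀) ≤ A₀B₁ + A₁B₀ ≤ A₀B₀ + A₁B₁ ≤ Z·(N₀₀ + N₁₁)` (`Z = 2^{|F_W|}`, the middle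
  step is `(A₁ − A₀)(B₁ − B₀) ≥ 0`) — `OneCopy.cube_four_kleitman`;
* summing the slices (`Finset.card_eq_sum_card_fiberwise` over `W`, then `Consts.HardCoreReduction.card_filter_fibre_split` along `F_W`)
  gives the four counts of the conjecture.
`T = ∅` is Harris fibrewise; the same slicing does NOT work for PA-BERN (`Consts.FibrewiseBHK`: conditioning the second copy constrains
`y`) nor for `Consts.OneCopyContainBHK` / `Consts.CrossReachBHK` (there the natural slice freezes `C_S` of the first copy) — those stay open.
Exact verification of every step of the slice argument (lead gen 106, `lab-gen106/hc/slice_check.py`): all graphs `n ≤ 5, m ≤ 7`,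
`|S| ≤ 2`, `|T| ≤ 2`: 101 084 slices, 12 020 774 (slice, event-pair) instances, 0 failures.
[cite: Kleitman1966, Lemma] [cite: Harris1960, Lemma 4.1] [cite: VandenbergHaggstromKahn2005, §1 p. 4 (identity (6): locality of `C_S` on `{S ↮ T}`)]
[cite: Linusson2011, Prop. 2.6]
-/

noncomputable section

namespace Summit.CriticalPhenomena.PercolationContinuityZ3.Theorems

open Set Literature.Probability.Percolation Literature.Probability.Percolation.FoldingFibre
open scoped Classical symmDiff

namespace Consts

namespace OneCopy

/-! ## The slice inequality and the decomposition of the four counts -/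

section Slice

variable {n : ℕ}

/-- The cube `{y ⊆ F}` as a filter of `univ` versus the folding fibre `fibre F ∅`. [folklore] -/
theorem card_fibre_empty_filter (F : Set (Sym2 (Fin n))) (r : Set (Sym2 (Fin n)) → Prop) [DecidablePred r] :
    ((fibre F ∅).filter r).card = (Finset.univ.filter fun y : Set (Sym2 (Fin n)) => y ⊆ F ∧ r y).card := by
  rw [← Finset.filter_univ_mem (fibre F ∅), Finset.filter_filter]
  refine congrArg Finset.card ?_
  ext y
  simp only [Finset.mem_filter, Finset.mem_univ, true_and, mem_fibre_empty_iff]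

/-- **The slice inequality.**  On the slice of the first copy with reach set `W` of `T` (disjoint from `S`) and fixed part `x`
(`x ∩ F = ∅`, `F = M ∩ {pairs away from W}`), the four block counts over `y ⊆ F` satisfy
`N(P₀∧Q₁) + N(Q₀∧P₁) ≤ N(P₀∧Q₀) + N(P₁∧Q₁)` (`P₀ = P(C_S(x ∪ y))`, `P₁ = P(C_S((x ∪ y) ∆ M))`, …): the cube inequality
`cube_four_kleitman` with domination from `cluster_subset_reflected`. [this work] -/
theorem slice_ineq (S T : Set (Fin n)) (P Q : Set (Sym2 (Fin n)) → Prop)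
    (hP : ∀ ⦃C C' : Set (Sym2 (Fin n))⦄, C ⊆ C' → P C → P C')
    (hQ : ∀ ⦃C C' : Set (Sym2 (Fin n))⦄, C ⊆ C' → Q C → Q C')
    (M : Set (Sym2 (Fin n))) (W : Set (Fin n)) (x : BondConfig (Fin n))
    (hW : {v | ∃ t ∈ T, (openGraph x).Reachable t v} = W) (hS : ∀ s ∈ S, s ∉ W)
    (hxF : x ∩ (M ∩ {e | ∀ z ∈ e, z ∉ W}) = ∅) :
    (Finset.univ.filter fun y : Set (Sym2 (Fin n)) => y ⊆ M ∩ {e | ∀ z ∈ e, z ∉ W} ∧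
        (P (⋃ s ∈ S, openEdgeCluster (x ∪ y) s) ∧ Q (⋃ s ∈ S, openEdgeCluster ((x ∪ y) ∆ M) s))).card +
    (Finset.univ.filter fun y : Set (Sym2 (Fin n)) => y ⊆ M ∩ {e | ∀ z ∈ e, z ∉ W} ∧
        (Q (⋃ s ∈ S, openEdgeCluster (x ∪ y) s) ∧ P (⋃ s ∈ S, openEdgeCluster ((x ∪ y) ∆ M) s))).card ≤
    (Finset.univ.filter fun y : Set (Sym2 (Fin n)) => y ⊆ M ∩ {e | ∀ z ∈ e, z ∉ W} ∧
        (P (⋃ s ∈ S, openEdgeCluster (x ∪ y) s) ∧ Q (⋃ s ∈ S, openEdgeCluster (x ∪ y) s))).card +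
    (Finset.univ.filter fun y : Set (Sym2 (Fin n)) => y ⊆ M ∩ {e | ∀ z ∈ e, z ∉ W} ∧
        (P (⋃ s ∈ S, openEdgeCluster ((x ∪ y) ∆ M) s) ∧ Q (⋃ s ∈ S, openEdgeCluster ((x ∪ y) ∆ M) s))).card := by
  set F : Set (Sym2 (Fin n)) := M ∩ {e | ∀ z ∈ e, z ∉ W} with hFdef
  have hFM : F ⊆ M := Set.inter_subset_left
  have hFW : ∀ e ∈ F, ∀ z ∈ e, z ∉ W := fun e he => he.2
  have hMF : ∀ e ∈ M, (∀ z ∈ e, z ∉ W) → e ∈ F := fun e he h => ⟨he, h⟩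
  -- the second copy on the slice: `(x ∪ y) ∆ M = (x ∆ M) \ y`
  have hsd : ∀ y : Set (Sym2 (Fin n)), y ⊆ F → (x ∪ y) ∆ M = (x ∆ M) \ y :=
    fun y hy => union_symmDiff_eq_sdiff hxF hy hFM
  -- the four cube predicates
  have hmonoC : ∀ ⦃ω ω' : BondConfig (Fin n)⦄, ω ⊆ ω' →
      (⋃ s ∈ S, openEdgeCluster ω s) ⊆ (⋃ s ∈ S, openEdgeCluster ω' s) :=
    fun ω ω' hle => Set.iUnion₂_mono fun s _ => BHK2006.openEdgeCluster_mono hle s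
  have hp₀ : ∀ y ⊆ F, ∀ y' ⊆ F, y ⊆ y' → P (⋃ s ∈ S, openEdgeCluster (x ∪ y) s) → P (⋃ s ∈ S, openEdgeCluster (x ∪ y') s) :=
    fun y _ y' _ hyy' => hP (hmonoC (Set.union_subset_union_right x hyy'))
  have hq₀ : ∀ y ⊆ F, ∀ y' ⊆ F, y ⊆ y' → Q (⋃ s ∈ S, openEdgeCluster (x ∪ y) s) → Q (⋃ s ∈ S, openEdgeCluster (x ∪ y') s) :=
    fun y _ y' _ hyy' => hQ (hmonoC (Set.union_subset_union_right x hyy'))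
  have hp₁ : ∀ y ⊆ F, ∀ y' ⊆ F, y ⊆ y' → P (⋃ s ∈ S, openEdgeCluster ((x ∆ M) \ y') s) → P (⋃ s ∈ S, openEdgeCluster ((x ∆ M) \ y) s) :=
    fun y _ y' _ hyy' => hP (hmonoC (Set.sdiff_subset_sdiff_right hyy'))
  have hq₁ : ∀ y ⊆ F, ∀ y' ⊆ F, y ⊆ y' → Q (⋃ s ∈ S, openEdgeCluster ((x ∆ M) \ y') s) → Q (⋃ s ∈ S, openEdgeCluster ((x ∆ M) \ y) s) :=
    fun y _ y' _ hyy' => hQ (hmonoC (Set.sdiff_subset_sdiff_right hyy'))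
  -- domination by reflection + `cluster_subset_reflected`
  have hdom : ∀ (R : Set (Sym2 (Fin n)) → Prop), (∀ ⦃C C' : Set (Sym2 (Fin n))⦄, C ⊆ C' → R C → R C') →
      ((fibre F ∅).filter fun y => R (⋃ s ∈ S, openEdgeCluster (x ∪ y) s)).card ≤
        ((fibre F ∅).filter fun y => R (⋃ s ∈ S, openEdgeCluster ((x ∆ M) \ y) s)).card := by
    intro R hR
    have hre := card_filter_symmDiff_mem F ∅ {y | R (⋃ s ∈ S, openEdgeCluster ((x ∆ M) \ y) s)}
    simp only [Set.mem_setOf_eq] at hre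
    calc ((fibre F ∅).filter fun y => R (⋃ s ∈ S, openEdgeCluster (x ∪ y) s)).card
        ≤ ((fibre F ∅).filter fun y => R (⋃ s ∈ S, openEdgeCluster ((x ∆ M) \ (y ∆ F)) s)).card := by
          refine Finset.card_le_card fun y hy => ?_
          rw [Finset.mem_filter] at hy ⊢
          have hyF : y ⊆ F := mem_fibre_empty_iff.1 hy.1
          refine ⟨hy.1, ?_⟩
          rw [symmDiff_eq_sdiff_of_subset hyF]
          exact hR (cluster_subset_reflected hW hS hFW hMF hFM hxF hyF) hy.2
      _ = ((fibre F ∅).filter fun y => R (⋃ s ∈ S, openEdgeCluster ((x ∆ M) \ y) s)).card := by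
          convert hre using 3
  have key := cube_four_kleitman F
    (fun y => P (⋃ s ∈ S, openEdgeCluster (x ∪ y) s)) (fun y => Q (⋃ s ∈ S, openEdgeCluster (x ∪ y) s))
    (fun y => P (⋃ s ∈ S, openEdgeCluster ((x ∆ M) \ y) s)) (fun y => Q (⋃ s ∈ S, openEdgeCluster ((x ∆ M) \ y) s))
    hp₀ hq₀ hp₁ hq₁ (hdom P hP) (hdom Q hQ)
  rw [card_fibre_empty_filter, card_fibre_empty_filter, card_fibre_empty_filter, card_fibre_empty_filter] at key
  -- rewrite the second copy `(x ∪ y) ∆ M` as `(x ∆ M) \ y` in the goal (valid for `y ⊆ F`)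
  have e1 : (Finset.univ.filter fun y : Set (Sym2 (Fin n)) => y ⊆ F ∧
        (P (⋃ s ∈ S, openEdgeCluster (x ∪ y) s) ∧ Q (⋃ s ∈ S, openEdgeCluster ((x ∪ y) ∆ M) s))) =
      (Finset.univ.filter fun y : Set (Sym2 (Fin n)) => y ⊆ F ∧
        (P (⋃ s ∈ S, openEdgeCluster (x ∪ y) s) ∧ Q (⋃ s ∈ S, openEdgeCluster ((x ∆ M) \ y) s))) :=
    Finset.filter_congr fun y _ => by
      constructor
      · rintro ⟨hy, h⟩; rw [hsd y hy] at h; exact ⟨hy, h⟩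
      · rintro ⟨hy, h⟩; rw [← hsd y hy] at h; exact ⟨hy, h⟩
  have e2 : (Finset.univ.filter fun y : Set (Sym2 (Fin n)) => y ⊆ F ∧
        (Q (⋃ s ∈ S, openEdgeCluster (x ∪ y) s) ∧ P (⋃ s ∈ S, openEdgeCluster ((x ∪ y) ∆ M) s))) =
      (Finset.univ.filter fun y : Set (Sym2 (Fin n)) => y ⊆ F ∧
        (P (⋃ s ∈ S, openEdgeCluster ((x ∆ M) \ y) s) ∧ Q (⋃ s ∈ S, openEdgeCluster (x ∪ y) s))) :=
    Finset.filter_congr fun y _ => by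
      constructor
      · rintro ⟨hy, h1, h2⟩; rw [hsd y hy] at h2; exact ⟨hy, h2, h1⟩
      · rintro ⟨hy, h1, h2⟩; rw [← hsd y hy] at h1; exact ⟨hy, h2, h1⟩
  have e4 : (Finset.univ.filter fun y : Set (Sym2 (Fin n)) => y ⊆ F ∧
        (P (⋃ s ∈ S, openEdgeCluster ((x ∪ y) ∆ M) s) ∧ Q (⋃ s ∈ S, openEdgeCluster ((x ∪ y) ∆ M) s))) =
      (Finset.univ.filter fun y : Set (Sym2 (Fin n)) => y ⊆ F ∧
        (P (⋃ s ∈ S, openEdgeCluster ((x ∆ M) \ y) s) ∧ Q (⋃ s ∈ S, openEdgeCluster ((x ∆ M) \ y) s))) :=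
    Finset.filter_congr fun y _ => by
      constructor
      · rintro ⟨hy, h⟩; rw [hsd y hy] at h; exact ⟨hy, h⟩
      · rintro ⟨hy, h⟩; rw [← hsd y hy] at h; exact ⟨hy, h⟩
  rw [e1, e2, e4]
  exact key

end Slice

/-! ## Decomposition of the four counts along the slices, and the theorem -/

section Assembly

variable {n : ℕ}

/-- **Slice decomposition of a one-copy count.**  For a relation `R` between the two union clusters, the fibre count
`#{a : a \ M = u, S ↮ T in a, R(C_S(a), C_S(a ∆ M))}` is the sum, over the reach set `W` of `T` in the first copy and the fixed part
`x` of the slice, of the block counts `#{y ⊆ F_W : R(C_S(x ∪ y), C_S((x ∪ y) ∆ M))}` (`F_W = M ∩ {pairs away from W}`):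
`Finset.card_eq_sum_card_fiberwise` over `W`, then `Consts.HardCoreReduction.card_filter_fibre_split` along `F_W`, legitimate because
the reach set of `T` does not see the pairs away from it (`reachSet_sdiff_eq`, `reachSet_eq_of_sdiff`). [this work] -/
theorem count_decomp (S T : Set (Fin n)) (M u : Set (Sym2 (Fin n))) (hu : Disjoint u M)
    (R : Set (Sym2 (Fin n)) → Set (Sym2 (Fin n)) → Prop) :
    (Finset.univ.filter fun a : BondConfig (Fin n) => a \ M = u ∧
        ((∀ s ∈ S, ∀ t ∈ T, ¬ (openGraph a).Reachable s t) ∧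
          R (⋃ s ∈ S, openEdgeCluster a s) (⋃ s ∈ S, openEdgeCluster (a ∆ M) s))).card =
      ∑ W : Set (Fin n), ∑ x ∈ Finset.univ.filter (fun x : BondConfig (Fin n) =>
          x \ (M \ (M ∩ {e | ∀ z ∈ e, z ∉ W})) = u ∧ ((∀ s ∈ S, s ∉ W) ∧ {v | ∃ t ∈ T, (openGraph x).Reachable t v} = W)),
        (Finset.univ.filter fun y : Set (Sym2 (Fin n)) => y ⊆ M ∩ {e | ∀ z ∈ e, z ∉ W} ∧
          R (⋃ s ∈ S, openEdgeCluster (x ∪ y) s) (⋃ s ∈ S, openEdgeCluster ((x ∪ y) ∆ M) s)).card := by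
  rw [Finset.card_eq_sum_card_fiberwise (f := fun a : BondConfig (Fin n) => {v | ∃ t ∈ T, (openGraph a).Reachable t v})
    (t := (Finset.univ : Finset (Set (Fin n)))) (fun a _ => Finset.mem_univ _)]
  refine Finset.sum_congr rfl fun W _ => ?_
  rw [Finset.filter_filter]
  set F : Set (Sym2 (Fin n)) := M ∩ {e | ∀ z ∈ e, z ∉ W} with hFdef
  have hFM : F ⊆ M := Set.inter_subset_left
  have huF : Disjoint u F := hu.mono_right hFM
  have hFW : ∀ e ∈ F, ∀ z ∈ e, z ∉ W := fun e he => he.2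
  have step := HardCoreReduction.card_filter_fibre_split M u F hFM huF
    (fun a => ((∀ s ∈ S, ∀ t ∈ T, ¬ (openGraph a).Reachable s t) ∧
        R (⋃ s ∈ S, openEdgeCluster a s) (⋃ s ∈ S, openEdgeCluster (a ∆ M) s)) ∧
      {v | ∃ t ∈ T, (openGraph a).Reachable t v} = W)
    (fun x => (∀ s ∈ S, s ∉ W) ∧ {v | ∃ t ∈ T, (openGraph x).Reachable t v} = W)
    (fun x y => R (⋃ s ∈ S, openEdgeCluster (x ∪ y) s) (⋃ s ∈ S, openEdgeCluster ((x ∪ y) ∆ M) s)) ?_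
  · -- `convert` absorbs the decidability instances (abstract `Cond`/`Good`/`Rel` versus the concrete predicates); the fibre of
    -- the reach-set map is the filter of `Cond`
    convert step using 2 <;> (ext a; simp only [Finset.mem_filter, Finset.mem_univ, true_and]; try tauto)
  -- the slice condition: `Cond a ↔ Good (a \ F) ∧ Rel (a \ F) (a ∩ F)`
  intro a _
  simp only [Set.sdiff_union_inter]
  constructor
  · rintro ⟨⟨hB, hR⟩, hWa⟩
    have hS : ∀ s ∈ S, s ∉ W := by
      intro s hs hsW
      rw [← hWa] at hsW
      obtain ⟨t, ht, hts⟩ := hsW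
      exact hB s hs t ht hts.symm
    exact ⟨⟨hS, reachSet_sdiff_eq hWa hFW⟩, hR⟩
  · rintro ⟨⟨hS, hWx⟩, hR⟩
    have hWa : {v | ∃ t ∈ T, (openGraph a).Reachable t v} = W := reachSet_eq_of_sdiff hWx hFW
    refine ⟨⟨fun s hs t ht hst => hS s hs ?_, hR⟩, hWa⟩
    rw [← hWa]
    exact ⟨t, ht, hst.symm⟩

end Assembly

end OneCopy

/-- **THEOREM — one-copy repulsion holds fibrewise: `Consts.OneCopyRepelBHK`.**  For every `n`, source set `S`, vertex set `T`,
increasing cluster predicates `P, Q` and every folding fibre `(M, u)`: conditioning the FIRST copy `a` to avoid `T` (the second copy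
`a ∆ M` free), `N(B∩U_P ; U_Q) + N(B∩U_Q ; U_P) ≤ N(B∩U_P∩U_Q ; ⊤) + N(B ; U_P∩U_Q)`.  Proof: slice by the reach set of `T` in the
first copy and the slice's fixed part (`OneCopy.count_decomp`), and on each slice apply the cube inequality (`OneCopy.slice_ineq`:
Kleitman's lemma four times with domination by reflection).  Summed with the Bernstein weights of the fibres this re-proves the
measure-level `Consts.oneCopyRepel_measure`; `T = ∅` is Harris fibrewise; the analogous slicing fails for `Consts.FibrewiseBHK`
(PA-BERN), `Consts.OneCopyContainBHK` and `Consts.CrossReachBHK`, which remain open. [this work]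
[cite: Kleitman1966, Lemma] [cite: Harris1960, Lemma 4.1] [cite: VandenbergHaggstromKahn2005, §1 p. 4 (identity (6))] -/
theorem oneCopyRepelBHK_holds : OneCopyRepelBHK := by
  intro n S T P Q hP hQ M u hu
  -- the four counts in the normal form of `OneCopy.count_decomp`
  have e1 : (Finset.univ.filter fun a : BondConfig (Fin n) =>
        a \ M = u ∧ (a ∈ {ω : BondConfig (Fin n) | ∀ s ∈ S, ∀ t ∈ T, ¬ (openGraph ω).Reachable s t} ∧
          P (⋃ s ∈ S, openEdgeCluster a s)) ∧ Q (⋃ s ∈ S, openEdgeCluster (a ∆ M) s)) =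
      (Finset.univ.filter fun a : BondConfig (Fin n) => a \ M = u ∧
        ((∀ s ∈ S, ∀ t ∈ T, ¬ (openGraph a).Reachable s t) ∧
          (P (⋃ s ∈ S, openEdgeCluster a s) ∧ Q (⋃ s ∈ S, openEdgeCluster (a ∆ M) s)))) :=
    Finset.filter_congr fun a _ => by simp only [Set.mem_setOf_eq]; tauto
  have e2 : (Finset.univ.filter fun a : BondConfig (Fin n) =>
        a \ M = u ∧ (a ∈ {ω : BondConfig (Fin n) | ∀ s ∈ S, ∀ t ∈ T, ¬ (openGraph ω).Reachable s t} ∧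
          Q (⋃ s ∈ S, openEdgeCluster a s)) ∧ P (⋃ s ∈ S, openEdgeCluster (a ∆ M) s)) =
      (Finset.univ.filter fun a : BondConfig (Fin n) => a \ M = u ∧
        ((∀ s ∈ S, ∀ t ∈ T, ¬ (openGraph a).Reachable s t) ∧
          (Q (⋃ s ∈ S, openEdgeCluster a s) ∧ P (⋃ s ∈ S, openEdgeCluster (a ∆ M) s)))) :=
    Finset.filter_congr fun a _ => by simp only [Set.mem_setOf_eq]; tauto
  have e3 : (Finset.univ.filter fun a : BondConfig (Fin n) =>
        a \ M = u ∧ (a ∈ {ω : BondConfig (Fin n) | ∀ s ∈ S, ∀ t ∈ T, ¬ (openGraph ω).Reachable s t} ∧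
          P (⋃ s ∈ S, openEdgeCluster a s) ∧ Q (⋃ s ∈ S, openEdgeCluster a s)) ∧ True) =
      (Finset.univ.filter fun a : BondConfig (Fin n) => a \ M = u ∧
        ((∀ s ∈ S, ∀ t ∈ T, ¬ (openGraph a).Reachable s t) ∧
          (P (⋃ s ∈ S, openEdgeCluster a s) ∧ Q (⋃ s ∈ S, openEdgeCluster a s)))) :=
    Finset.filter_congr fun a _ => by simp only [Set.mem_setOf_eq]; tauto
  have e4 : (Finset.univ.filter fun a : BondConfig (Fin n) =>
        a \ M = u ∧ a ∈ {ω : BondConfig (Fin n) | ∀ s ∈ S, ∀ t ∈ T, ¬ (openGraph ω).Reachable s t} ∧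
          (P (⋃ s ∈ S, openEdgeCluster (a ∆ M) s) ∧ Q (⋃ s ∈ S, openEdgeCluster (a ∆ M) s))) =
      (Finset.univ.filter fun a : BondConfig (Fin n) => a \ M = u ∧
        ((∀ s ∈ S, ∀ t ∈ T, ¬ (openGraph a).Reachable s t) ∧
          (P (⋃ s ∈ S, openEdgeCluster (a ∆ M) s) ∧ Q (⋃ s ∈ S, openEdgeCluster (a ∆ M) s)))) :=
    Finset.filter_congr fun a _ => by simp only [Set.mem_setOf_eq]
  rw [e1, e2, e3, e4]
  -- the slice decompositions of the four counts (`convert` absorbs the decidability instances)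
  have d1 : (Finset.univ.filter fun a : BondConfig (Fin n) => a \ M = u ∧
        ((∀ s ∈ S, ∀ t ∈ T, ¬ (openGraph a).Reachable s t) ∧
          (P (⋃ s ∈ S, openEdgeCluster a s) ∧ Q (⋃ s ∈ S, openEdgeCluster (a ∆ M) s)))).card =
      ∑ W : Set (Fin n), ∑ x ∈ Finset.univ.filter (fun x : BondConfig (Fin n) =>
          x \ (M \ (M ∩ {e | ∀ z ∈ e, z ∉ W})) = u ∧ ((∀ s ∈ S, s ∉ W) ∧ {v | ∃ t ∈ T, (openGraph x).Reachable t v} = W)),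
        (Finset.univ.filter fun y : Set (Sym2 (Fin n)) => y ⊆ M ∩ {e | ∀ z ∈ e, z ∉ W} ∧
          (P (⋃ s ∈ S, openEdgeCluster (x ∪ y) s) ∧ Q (⋃ s ∈ S, openEdgeCluster ((x ∪ y) ∆ M) s))).card := by
    convert OneCopy.count_decomp S T M u hu (fun C C' => P C ∧ Q C') using 10
  have d2 : (Finset.univ.filter fun a : BondConfig (Fin n) => a \ M = u ∧
        ((∀ s ∈ S, ∀ t ∈ T, ¬ (openGraph a).Reachable s t) ∧
          (Q (⋃ s ∈ S, openEdgeCluster a s) ∧ P (⋃ s ∈ S, openEdgeCluster (a ∆ M) s)))).card =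
      ∑ W : Set (Fin n), ∑ x ∈ Finset.univ.filter (fun x : BondConfig (Fin n) =>
          x \ (M \ (M ∩ {e | ∀ z ∈ e, z ∉ W})) = u ∧ ((∀ s ∈ S, s ∉ W) ∧ {v | ∃ t ∈ T, (openGraph x).Reachable t v} = W)),
        (Finset.univ.filter fun y : Set (Sym2 (Fin n)) => y ⊆ M ∩ {e | ∀ z ∈ e, z ∉ W} ∧
          (Q (⋃ s ∈ S, openEdgeCluster (x ∪ y) s) ∧ P (⋃ s ∈ S, openEdgeCluster ((x ∪ y) ∆ M) s))).card := by
    convert OneCopy.count_decomp S T M u hu (fun C C' => Q C ∧ P C') using 10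
  have d3 : (Finset.univ.filter fun a : BondConfig (Fin n) => a \ M = u ∧
        ((∀ s ∈ S, ∀ t ∈ T, ¬ (openGraph a).Reachable s t) ∧
          (P (⋃ s ∈ S, openEdgeCluster a s) ∧ Q (⋃ s ∈ S, openEdgeCluster a s)))).card =
      ∑ W : Set (Fin n), ∑ x ∈ Finset.univ.filter (fun x : BondConfig (Fin n) =>
          x \ (M \ (M ∩ {e | ∀ z ∈ e, z ∉ W})) = u ∧ ((∀ s ∈ S, s ∉ W) ∧ {v | ∃ t ∈ T, (openGraph x).Reachable t v} = W)),
        (Finset.univ.filter fun y : Set (Sym2 (Fin n)) => y ⊆ M ∩ {e | ∀ z ∈ e, z ∉ W} ∧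
          (P (⋃ s ∈ S, openEdgeCluster (x ∪ y) s) ∧ Q (⋃ s ∈ S, openEdgeCluster (x ∪ y) s))).card := by
    convert OneCopy.count_decomp S T M u hu (fun C C' => P C ∧ Q C) using 10
  have d4 : (Finset.univ.filter fun a : BondConfig (Fin n) => a \ M = u ∧
        ((∀ s ∈ S, ∀ t ∈ T, ¬ (openGraph a).Reachable s t) ∧
          (P (⋃ s ∈ S, openEdgeCluster (a ∆ M) s) ∧ Q (⋃ s ∈ S, openEdgeCluster (a ∆ M) s)))).card =
      ∑ W : Set (Fin n), ∑ x ∈ Finset.univ.filter (fun x : BondConfig (Fin n) =>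
          x \ (M \ (M ∩ {e | ∀ z ∈ e, z ∉ W})) = u ∧ ((∀ s ∈ S, s ∉ W) ∧ {v | ∃ t ∈ T, (openGraph x).Reachable t v} = W)),
        (Finset.univ.filter fun y : Set (Sym2 (Fin n)) => y ⊆ M ∩ {e | ∀ z ∈ e, z ∉ W} ∧
          (P (⋃ s ∈ S, openEdgeCluster ((x ∪ y) ∆ M) s) ∧ Q (⋃ s ∈ S, openEdgeCluster ((x ∪ y) ∆ M) s))).card := by
    convert OneCopy.count_decomp S T M u hu (fun C C' => P C' ∧ Q C') using 10
  rw [d1, d2, d3, d4, ← Finset.sum_add_distrib, ← Finset.sum_add_distrib]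
  refine Finset.sum_le_sum fun W _ => ?_
  rw [← Finset.sum_add_distrib, ← Finset.sum_add_distrib]
  refine Finset.sum_le_sum fun x hx => ?_
  rw [Finset.mem_filter] at hx
  obtain ⟨-, hxu, hS, hW⟩ := hx
  have huF : Disjoint u (M ∩ {e | ∀ z ∈ e, z ∉ W}) := hu.mono_right Set.inter_subset_left
  have hxF := OneCopy.inter_eq_empty_of_sdiff_eq hxu huF
  exact OneCopy.slice_ineq S T P Q hP hQ M W x hW hS hxF

end Consts

end Summit.CriticalPhenomena.PercolationContinuityZ3.Theorems
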